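import Summits.BirchSwinnertonDyer.BirchSwinnertonDyer.Theorems.AlignedTransportAtTwoMainConjectureOfRankZeroBSDAtTwoSelmerLayerMuDoorComplete
import HarnessLib

/-!
# Route `AlignedTransportAtTwo`, crux C2 `MainConjectureOfRankZeroBSDAtTwo` (stmt-BirchSwinnertonDyer-22298):
# the Selmer rank-jump `μ`-door and its completeness in the TOWER road's currency `#{z ∈ Sel_n | 2•z = 0}`

HONEST FRAMING (cell `bsd-f1-sign2`, WIDTH-5 attached prover seat `bsd-line-att-p5` gen 43; `--supports` stmt-BirchSwinnertonDyer-22298,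
closes nothing; BSD is NOT proved by any of this; C2, its verdict and every registered stub are untouched). THEOREMS ONLY. Bookkeeping:
the TOWER road of this cell (att-p4's 860 `Theorems/ByReductionTypeAtTwoTowerClass*.lean`, `KatoHalfPinch.towerGapAtTwo_of_layerSelmer_cert`)
displays its kit-certified layer Selmer counts as `Nat.card {z : W.selmerLayer κ j // 2 • z = 0}`, while `…SelmerLayerMuDoor{,Complete}` use the
`n`-torsion subgroup `(↥(W.selmerLayer κ j))[(2 : ℤ)]`. The two counts agree (`natCard_subtype_nsmul_eq_natCard_torsionBy`), so:

* ★★★ `isTorsion_and_mu_eq_zero_iff_exists_towerCurrency_two` — for every `W/ℚ` good ordinary at `2` without rational `2`-torsion, cyclotomic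
  `κ`, topological generator `γ`, dual datum `D`: **`(D.IsTorsion ∧ D.mu = 0)` ⟺ ∃ `j < k`,
  `#{z ∈ Sel_k | 2z = 0} · #ker g_k · 2^{2^j} < #{z ∈ Sel_j | 2z = 0} · 2^{2^k}`** — stub T at `(W,κ,γ,D)` in the currency of the tower
  certificates (`sel2tower.gp` counts `d_n`), COMPLETE.

References: R. Greenberg, LNM 1716 (1999), §1 Conj. 1.11, §3 Lemmas 3.1–3.5 [GreenbergLNM1716]; L. Washington, GTM 83, §13.3 [Washington1997].
-/

set_option linter.dupNamespace false
set_option autoImplicit false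

noncomputable section

open scoped Classical AddSubgroup

universe u

namespace Summit.BirchSwinnertonDyer.BirchSwinnertonDyer.Theorems.AlignedTransportAtTwoSelmerLayerMuDoorTowerCurrency

open WeierstrassCurve Literature.NumberTheory.EllipticCurves Literature.NumberTheory.EllipticCurves.Greenberg1999
  Summit.BirchSwinnertonDyer.BirchSwinnertonDyer.Theorems.AlignedTransportAtTwoSelmerLayerMuDoorComplete

/-- `#{g ∈ G | n•g = 0} = #G[n]` (the same set). [folklore] -/
theorem natCard_subtype_nsmul_eq_natCard_torsionBy (G : Type u) [AddCommGroup G] (n : ℕ) :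
    Nat.card {g : G // n • g = 0} = Nat.card (G[(n : ℤ)]) :=
  Nat.card_congr (Equiv.subtypeEquivRight fun _ ↦ AddSubgroup.torsionBy.nsmul_iff.symm)

variable (W : WeierstrassCurve ℚ) [W.IsElliptic] [W.IsGloballyMinimal]

/-- ★★★ **Stub T at `(W, κ, γ, D)` ⟺ the two-layer inequality, in the TOWER road's currency** (`W/ℚ` globally minimal, good ordinary at `2`,
no rational `2`-torsion; `κ` cyclotomic, `γ` a topological generator, ANY dual datum): `(D.IsTorsion ∧ D.mu = 0)` iff for some `j < k`
`#{z ∈ Sel_k | 2z = 0} · #ker g_k · 2^{2^j} < #{z ∈ Sel_j | 2z = 0} · 2^{2^k}` (`Sel_n = W.selmerLayer κ n`, `ker g_n = W.KerG κ n`).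
[cite: GreenbergLNM1716, §1 Conj. 1.11; §3 Lemmas 3.1–3.5] [cite: Washington1997, §13.3 Prop. 13.23] -/
theorem isTorsion_and_mu_eq_zero_iff_exists_towerCurrency_two (hord : IsOrdinaryAt W 2)
    (ht : ∀ x : ℚ, ¬ HasRationalTwoTorsionX W x) (κ : ZpExtension ℚ 2) (hκ : κ.IsCyclotomic)
    {γ : Field.absoluteGaloisGroup ℚ} (hγ : κ.IsTopGenerator γ) (D : W.SelmerDualData κ γ) :
    (D.IsTorsion ∧ D.mu = 0) ↔ ∃ j k : ℕ, j < k ∧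
      Nat.card {z : W.selmerLayer κ k // 2 • z = 0} * Nat.card (W.KerG κ k) * 2 ^ (2 ^ j) <
        Nat.card {z : W.selmerLayer κ j // 2 • z = 0} * 2 ^ (2 ^ k) := by
  rw [seedMuZero_iff_exists_selmer_rankJump_two W hord ht κ hκ hγ D]
  simp only [natCard_subtype_nsmul_eq_natCard_torsionBy, Nat.cast_ofNat]

end Summit.BirchSwinnertonDyer.BirchSwinnertonDyer.Theorems.AlignedTransportAtTwoSelmerLayerMuDoorTowerCurrency

end
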